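import Mathlib.LinearAlgebra.Dual.Lemmas
import Mathlib.LinearAlgebra.FiniteDimensional.Lemmas
import Mathlib.LinearAlgebra.Dimension.Constructions
import HarnessLib

/-!
# Golyshev–Lunts–Orlov, proof of Prop. 9.6.1: the second link «`J_{A×Â}Λ_{2,ℝ} ∩ Λ_{2,ℝ} = 0` ⟺
# `J_{A×Â}W ∩ W = 0` (∗)» for `Λ_{2,ℝ} = W ⊕ W^∘ ⊂ V_A ⊕ V_A^*`, coordinate-free

Venture cell `pub-hsemireg`, literature seat `lit-w-polishchuk-orlov` (g14, 2026-08-25). Companion of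
`GolyshevLuntsOrlovLagrangianFrame.lean` (LEMMA 9.6.2 and the FIRST link) and `GolyshevLuntsOrlovDualTori.lean`
(Lemma 9.4.5 in block form); none of them is imported (Mathlib + HarnessLib only).

PRINTED ([GolyshevLuntsOrlov2001MirrorAV] = Golyshev–Lunts–Orlov, «Mirror symmetry for abelian varieties»,
J. Algebraic Geom. 10 (2001) 433–496; arXiv math/9812003v2, text layer `widen/LIT-W/texts-po/glo01v2/`):
* 1.2 (p. 5 L48–56): «One has the dual torus `Â` defined as follows. Put `Γ* = Hom_ℤ(Γ, ℤ)`,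
  `V* = Γ* ⊗ ℝ = Hom(V, ℝ)` and `Ĵ : V* ⥲ V*`, s.t. `(Ĵw)(v) = w(−Jv)` for `v ∈ V`, `w ∈ V*`. Then by definition
  `Â = (V*/Γ*, Ĵ)`.»
* 3.1 (p. 7 L87–90): «Put `Λ = Γ ⊕ Γ*` with the canonical symmetric bilinear form `Q : Λ × Λ → ℤ` defined by
  `Q((a₁, b₁), (a₂, b₂)) = b₁(a₂) + b₂(a₁)`.»
* proof of Prop. 9.6.1 (p. 29 L101–143): a basis `e₁, …, e_n, e₋₁, …, e₋ₙ` of `Γ_A`, the dual basis `e*_{±i}`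
  of `Γ_Â`; «Put `Γ_i := ℤe_i ⊕ ℤe*₋ᵢ`, `Γ*_i := ℤe₋ᵢ ⊕ ℤe*ᵢ`, `i = 1, ..., n`. Clearly the subgroups
  `Λ₁ := ⊕Γ_i`, `Λ₂ := ⊕Γ*_i` are isotropic.»; (p. 30 L33–41): «This is equivalent to the statement that
  `J_{A×Â}Λ_{2,ℝ} ∩ Λ_{2,ℝ} = 0`. Put `W := ⊕ℝe₋ᵢ`. Then since `J_{A×Â}` preserves the form `Q_ℝ` the last
  equality is equivalent to `J_{A×Â}W ∩ W = 0`. (∗)»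

MODEL: `K` a field (print: `ℝ`); `V` = `V_A`, `finrank K V = 2n`; `Module.Dual K V` = `V* = V_Â`;
`J_{A×Â} = J ⊕ Ĵ = J.prodMap (−J.dualMap)` on `V × Dual K V` (`(−J.dualMap) w = −(w ∘ J)`, i.e. `(Ĵw)(v) = w(−Jv)`
as in 1.2); `Q_ℝ((a₁, b₁), (a₂, b₂)) = b₁(a₂) + b₂(a₁)` written pointwise; `Λ_{2,ℝ} = W.prod W.dualAnnihilator` —
indeed `⊕ℝe*ᵢ (i = 1 … n)` is exactly the annihilator of `W = ⊕ℝe₋ᵢ` in `V*` (dual basis), so `Λ_{2,ℝ} = W ⊕ W^∘`;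
«`JW ∩ W = 0`» = `W.map J ⊓ W = ⊥`.

## Results (PROVED; theorems only — no definition, no named fact, no `sorry`)
* `dualMap_dualMap` (`Ĵ² = −1`), `prodMap_sq` (`J_{A×Â}² = −1`), `prodMap_preserves_pairing` («`J_{A×Â}` preserves
  the form `Q_ℝ`»), `prod_dualAnnihilator_isotropic` («`Λ₂` … isotropic» for `Q_ℝ`), `finrank_prod_eq`,
  `finrank_prod_dualAnnihilator` (`dim Λ_{2,ℝ} = dim W + dim W^∘ = dim V`, one half of `dim(V ⊕ V*)`).
* `sup_map_eq_top`: `JW ∩ W = 0`, `dim W = n`, `dim V = 2n`, `J² = −1` ⟹ `W + JW = V`.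
* **`map_inf_eq_bot_iff`** — the SECOND LINK: for `dim V = 2n`, `dim W = n`, `J² = −1`:
  `J_{A×Â}Λ_{2,ℝ} ∩ Λ_{2,ℝ} = 0 ⟺ JW ∩ W = 0` (`⇒`: `(Jw, 0) = J_{A×Â}(w, 0)`; `⇐`: the `V`-component of a common
  vector lies in `JW ∩ W`, and its `V*`-component kills `W` and `JW`, hence `V = W + JW`). DERIVED HERE — the paper
  states the equivalence with the reason «since `J_{A×Â}` preserves the form `Q_ℝ`» (= `prodMap_preserves_pairing`,
  not needed by this proof).
* `example_plane`: the hypotheses AND (∗) are inhabited (`K = ℚ`, `V = ℚ²`, `J(a, b) = (−b, a)`, `W = ℚ·(1, 0)`,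
  `n = 1`).

Together with `GolyshevLuntsOrlovLagrangianFrame.nondegenerateOn_iff_map_inf_eq_bot` (instance
`(V ⊕ V*, Q_ℝ, Λ_{2,ℝ}, J_{A×Â})`: `Λ_{2,ℝ}` is `Q_ℝ`-Lagrangian by `prod_dualAnnihilator_isotropic` +
`finrank_prod_dualAnnihilator`, `J_{A×Â}² = −1` by `prodMap_sq`) and `nondegenerateOn_comp_iff` (the factor `I_{ω_A}`),
this is the last link of the printed chain «`Q_ℝ(I_{ω_A}J_{A×Â}(·), ·)` nondegenerate on `Λ_{2,ℝ}` ⟺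
`J_{A×Â}Λ_{2,ℝ} ∩ Λ_{2,ℝ} = 0` ⟺ (∗)»; the files are not imported into each other (the instantiation is a join left
to a reader), so each link stands alone, kernel-checked.

HONEST FRAMING: linear algebra only; lattices, tori, `I_{ω_A}`, Lemma 9.4.4 and the Zariski-density argument after
(∗) are NOT formalised; nothing here constructs a mirror pair or an abelian variety, or says HC holds.
-/

namespace Summit.Ventures.HSemireg.GolyshevLuntsOrlovTransversality

open Module Submodule

variable {K : Type*} [Field K] {V : Type*} [AddCommGroup V] [Module K V]

/-- `Ĵ(Ĵw) = −w` (here through `J.dualMap w = w ∘ J`: `(w ∘ J ∘ J)(v) = w(−v)`). -/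
theorem dualMap_dualMap (J : V →ₗ[K] V) (hJ : ∀ x, J (J x) = -x) (w : Dual K V) :
    J.dualMap (J.dualMap w) = -w := by
  ext v
  rw [LinearMap.dualMap_apply, LinearMap.dualMap_apply, hJ, map_neg, LinearMap.neg_apply]

/-- `J_{A×Â}² = −1` for `J_{A×Â} = J ⊕ Ĵ` [1.1 ∕ 1.2 for the torus `A × Â`]. -/
theorem prodMap_sq (J : V →ₗ[K] V) (hJ : ∀ x, J (J x) = -x) (p : V × Dual K V) :
    J.prodMap (-J.dualMap) (J.prodMap (-J.dualMap) p) = -p := by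
  obtain ⟨v, w⟩ := p
  simp only [LinearMap.prodMap_apply, LinearMap.neg_apply, map_neg, neg_neg, hJ, dualMap_dualMap J hJ,
    Prod.neg_mk]

/-- «since `J_{A×Â}` preserves the form `Q_ℝ`» (p. 30 L37–38; `Q` of 3.1): for `p = (a₁, b₁)`, `q = (a₂, b₂)`,
`Q(J_{A×Â}p, J_{A×Â}q) = Q(p, q) = b₁(a₂) + b₂(a₁)`. -/
theorem prodMap_preserves_pairing (J : V →ₗ[K] V) (hJ : ∀ x, J (J x) = -x) (p q : V × Dual K V) :
    (J.prodMap (-J.dualMap) p).2 ((J.prodMap (-J.dualMap) q).1) +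
      (J.prodMap (-J.dualMap) q).2 ((J.prodMap (-J.dualMap) p).1) = p.2 q.1 + q.2 p.1 := by
  simp only [LinearMap.prodMap_apply, LinearMap.neg_apply, LinearMap.dualMap_apply, hJ, map_neg, neg_neg]

/-- «Clearly the subgroups … `Λ₂ := ⊕Γ*_i` are isotropic» (p. 29 L140–143): `Q_ℝ` vanishes identically on
`Λ_{2,ℝ} = W ⊕ W^∘`. -/
theorem prod_dualAnnihilator_isotropic (W : Submodule K V) (p q : V × Dual K V)
    (hp : p ∈ W.prod W.dualAnnihilator) (hq : q ∈ W.prod W.dualAnnihilator) : p.2 q.1 + q.2 p.1 = 0 := by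
  rw [mem_prod, mem_dualAnnihilator] at hp hq
  rw [hp.2 q.1 hq.1, hq.2 p.1 hp.1, add_zero]

/-- `dim (W × W′) = dim W + dim W′` for submodules `W ≤ V`, `W′ ≤ V′` (through `W.prod W′ ≃ W × W′`). -/
theorem finrank_prod_eq {V' : Type*} [AddCommGroup V'] [Module K V'] [FiniteDimensional K V]
    [FiniteDimensional K V'] (W : Submodule K V) (W' : Submodule K V') :
    finrank K (W.prod W') = finrank K W + finrank K W' := by
  let e : (W.prod W') ≃ₗ[K] (W × W') :=
    { toFun := fun x => (⟨x.1.1, (mem_prod.mp x.2).1⟩, ⟨x.1.2, (mem_prod.mp x.2).2⟩)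
      invFun := fun y => ⟨(y.1.1, y.2.1), mem_prod.mpr ⟨y.1.2, y.2.2⟩⟩
      map_add' := fun _ _ => rfl
      map_smul' := fun _ _ => rfl
      left_inv := fun _ => rfl
      right_inv := fun _ => rfl }
  rw [e.finrank_eq, Module.finrank_prod]

/-- `dim Λ_{2,ℝ} = dim W + dim W^∘ = dim V` — one half of `dim (V ⊕ V*) = 2 dim V`, so the isotropic `Λ_{2,ℝ}` is
`Q_ℝ`-Lagrangian. -/
theorem finrank_prod_dualAnnihilator [FiniteDimensional K V] (W : Submodule K V) :
    finrank K (W.prod W.dualAnnihilator) = finrank K V := by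
  rw [finrank_prod_eq, Subspace.finrank_add_finrank_dualAnnihilator_eq]

/-- `JW ∩ W = 0` with `dim W = n`, `dim V = 2n` (and `J` invertible, here `J² = −1`) forces `W + JW = V`. -/
theorem sup_map_eq_top [FiniteDimensional K V] (J : V →ₗ[K] V) (hJ : ∀ x, J (J x) = -x)
    (W : Submodule K V) {n : ℕ} (hdim : finrank K V = 2 * n) (hWn : finrank K W = n)
    (h : W.map J ⊓ W = ⊥) : W ⊔ W.map J = ⊤ := by
  have h₁ : J.comp (-J) = LinearMap.id := by ext x; simp [hJ]
  have h₂ : (-J).comp J = LinearMap.id := by ext x; simp [hJ]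
  have hJW : finrank K (W.map J) = n := by
    rw [← hWn]; exact LinearEquiv.finrank_map_eq (LinearEquiv.ofLinear J (-J) h₁ h₂) W
  have hinf : W ⊓ W.map J = ⊥ := by rw [inf_comm]; exact h
  have hsum := Submodule.finrank_sup_add_finrank_inf_eq W (W.map J)
  rw [hinf, finrank_bot, add_zero, hWn, hJW] at hsum
  exact Submodule.eq_top_of_finrank_eq (by rw [hsum, hdim, two_mul])

/-- **The second link of p. 30 L33–41** (proof of Prop. 9.6.1): for `dim V = 2n`, `dim W = n` and `J² = −1`,
«`J_{A×Â}Λ_{2,ℝ} ∩ Λ_{2,ℝ} = 0`» ⟺ «`J_{A×Â}W ∩ W = 0` (∗)», where `Λ_{2,ℝ} = W ⊕ W^∘ ⊂ V ⊕ V*` and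
`J_{A×Â} = J ⊕ Ĵ`, `Ĵw = −w ∘ J` [cite: GolyshevLuntsOrlov2001MirrorAV, proof of Prop. 9.6.1, arXiv v2 p. 30 L33–41;
1.2; 3.1]. DERIVED HERE (`⇒` for every `W`; `⇐` through `W + JW = V`). -/
theorem map_inf_eq_bot_iff [FiniteDimensional K V] (J : V →ₗ[K] V) (hJ : ∀ x, J (J x) = -x)
    (W : Submodule K V) {n : ℕ} (hdim : finrank K V = 2 * n) (hWn : finrank K W = n) :
    (W.prod W.dualAnnihilator).map (J.prodMap (-J.dualMap)) ⊓ W.prod W.dualAnnihilator = ⊥ ↔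
      W.map J ⊓ W = ⊥ := by
  constructor
  · intro h
    rw [eq_bot_iff]
    intro v hv
    rw [mem_inf, mem_map] at hv
    obtain ⟨⟨w₀, hw₀, rfl⟩, hv2⟩ := hv
    have hmem : ((J w₀, 0) : V × Dual K V) ∈
        (W.prod W.dualAnnihilator).map (J.prodMap (-J.dualMap)) ⊓ W.prod W.dualAnnihilator :=
      mem_inf.mpr ⟨mem_map.mpr ⟨(w₀, 0), mem_prod.mpr ⟨hw₀, zero_mem _⟩, by
        rw [LinearMap.prodMap_apply, map_zero]⟩, mem_prod.mpr ⟨hv2, zero_mem _⟩⟩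
    rw [h, mem_bot, Prod.mk_eq_zero] at hmem
    rw [mem_bot]
    exact hmem.1
  · intro h
    rw [eq_bot_iff]
    intro p hp
    rw [mem_inf, mem_map] at hp
    obtain ⟨⟨q, hq, rfl⟩, hp2⟩ := hp
    rw [mem_prod] at hq
    rw [LinearMap.prodMap_apply, mem_prod] at hp2
    have h1 : J q.1 = 0 := by
      rw [← mem_bot K, ← h]
      exact mem_inf.mpr ⟨mem_map.mpr ⟨q.1, hq.1, rfl⟩, hp2.1⟩
    have hq1 : q.1 = 0 := by
      have := hJ q.1
      rw [h1, map_zero] at this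
      exact neg_eq_zero.mp this.symm
    have hq2 : q.2 ∈ (W ⊔ W.map J).dualAnnihilator := by
      rw [dualAnnihilator_sup_eq]
      refine mem_inf.mpr ⟨hq.2, (mem_dualAnnihilator _).mpr fun v hv => ?_⟩
      rw [mem_map] at hv
      obtain ⟨w, hw, rfl⟩ := hv
      have := (mem_dualAnnihilator _).mp hp2.2 w hw
      rw [LinearMap.neg_apply, LinearMap.neg_apply, LinearMap.dualMap_apply, neg_eq_zero] at this
      exact this
    rw [sup_map_eq_top J hJ W hdim hWn h, dualAnnihilator_top, mem_bot] at hq2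
    rw [mem_bot, LinearMap.prodMap_apply, hq1, hq2, map_zero, map_zero, Prod.mk_eq_zero]
    exact ⟨rfl, rfl⟩

/-- Non-vacuity of the hypotheses and of (∗): `K = ℚ`, `V = ℚ × ℚ`, `J(a, b) = (−b, a)`, `W = ℚ·(1, 0)`,
`n = 1`; then `JW = ℚ·(0, 1)` and `JW ∩ W = 0`. -/
theorem example_plane :
    ∃ (J : (ℚ × ℚ) →ₗ[ℚ] (ℚ × ℚ)) (W : Submodule ℚ (ℚ × ℚ)),
      (∀ x, J (J x) = -x) ∧ finrank ℚ (ℚ × ℚ) = 2 * 1 ∧ finrank ℚ W = 1 ∧ W.map J ⊓ W = ⊥ := by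
  let J : (ℚ × ℚ) →ₗ[ℚ] (ℚ × ℚ) := LinearMap.prod (-LinearMap.snd ℚ ℚ ℚ) (LinearMap.fst ℚ ℚ ℚ)
  have hJ : ∀ x : ℚ × ℚ, J x = (-x.2, x.1) := fun x => rfl
  have h10 : ((1, 0) : ℚ × ℚ) ≠ 0 := by simp
  refine ⟨J, span ℚ {((1, 0) : ℚ × ℚ)}, fun x => ?_, ?_, finrank_span_singleton h10, ?_⟩
  · rw [hJ, hJ]; ext <;> simp
  · rw [Module.finrank_prod, Module.finrank_self]
  · rw [eq_bot_iff]
    intro v hv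
    rw [mem_inf, mem_map] at hv
    obtain ⟨⟨w, hw, rfl⟩, hv2⟩ := hv
    rw [mem_span_singleton] at hw hv2
    obtain ⟨c, rfl⟩ := hw
    obtain ⟨c', hc'⟩ := hv2
    rw [hJ] at hc' ⊢
    have h2 := congrArg Prod.snd hc'
    simp only [Prod.smul_mk, smul_eq_mul, mul_one, mul_zero] at h2
    rw [mem_bot, Prod.mk_eq_zero]
    constructor
    · simp
    · simpa using h2.symm

end Summit.Ventures.HSemireg.GolyshevLuntsOrlovTransversality
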